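import Summits.QuantumFields.YangMills.Theorems.LuscherReductionDressedRitzPolyakovLiftStaticsPositivity
import Summits.QuantumFields.YangMills.Theorems.FemtoTransferGapAxisPermutation
import Summits.QuantumFields.YangMills.Theorems.FemtoTransferGapSlabFlowLiftAxisPermutation
import HarnessLib

/-!
# Line «polyakovlift» on crux `DressedRitz` (stmt-QuantumFields-20205), stub S-STAT `stub_liftStatics`:
# the covariance form of flowed Polyakov insertions is `S₃`-invariant — SYMMETRY ZEROS of clause (o2)

Fleet-service module of seat ym-infvol-p1 g5 (route `LuscherReduction`, femto rung R2b1), registered line «polyakovlift» (skeleton of record r2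
`62fcf7b4f9c136d2`, stub texts over the tree Defs `…DressedRitzPolyakovLiftDefs`).  Clause (o2) of S-STAT asks `|⟨u_i,u_l⟩| ≤ Cλ√⟨u_i,u_i⟩√⟨u_l,u_l⟩`
for the vacuum-subtracted flowed insertions `u_i = OpPlat.ins φ (flowLiftAt 0 t g_i)`.  Here is the part of that covariance matrix which
vanishes EXACTLY, by the symmetry the fine theory shares with the one-site model — the group `S₃` of permutations of the coordinate axes
(`configPerm π`; companions `…FemtoTransferGapAxisPermutation` = the transfer operator and every raw vacuum are invariant,
`…FemtoTransferGapSlabFlowLiftAxisPermutation` = the flowed Polyakov lift is equivariant):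

* §1 `l2_ins_ins` — `⟨ins φ O, ins φ O'⟩ = ⟨Oφ, O'φ⟩ − ⟨φ,Oφ⟩⟨φ,O'φ⟩` (`‖φ‖ = 1`): the covariance form;
* §2 `l2_vac_flowLiftAt_comp_configPerm`, `l2_flowLiftAt_vac_comp_configPerm`, ★ `l2_ins_flowLiftAt_comp_configPerm` — for a raw vacuum `φ` the
  one- and two-point vacuum functions of flowed Polyakov insertions, hence the covariance form `(f, h) ↦ ⟨u_f, u_h⟩`, are INVARIANT under
  `f ↦ f ∘ configPerm π` (one-site axis permutation);
* §3 ★ `l2_ins_flowLiftAt_eq_zero_of_invariant` — SYMMETRY ZERO: if `f` is `S₃`-invariant and `h` has vanishing `S₃`-average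
  (`Σ_π h ∘ P_π = 0`, i.e. no invariant component) then `⟨u_f, u_h⟩ = 0` EXACTLY (every raw vacuum, every flow time, every `L`, every `β`);
  ★ `l2_ins_flowLiftAt_eq_zero_of_sign` — the same for a sign-type `f` (`f ∘ P_π = sgn(π)·f`) against `h` with vanishing sign-twisted average;
* §4 `liftFamily_o2_of_symmetrySeparated` — hence clause (o2) holds with ANY `C ≥ 0` (indeed with `0`) for every pair of channels of a lift basis
  separated in this way: the OPEN content of (o2) is confined to pairs of one-site eigen-ratios inside the same `S₃`-isotypic class (e.g. two
  invariant levels), where the `O(λ)` bound is genuine femto-universe dynamics.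

HONEST FRAMING: exact symmetry bookkeeping at fixed lattice on the CONDITIONAL femto rung R2b1; it proves (o2) only for symmetry-separated pairs and
says nothing about the renormalisation-group estimate for same-sector pairs; nothing here bears on infinite volume, the continuum limit or the Clay
mass gap.  References: M. Lüscher, NPB 219 (1983) 233, §2 (cubic group, sectors) [cite: Luscher1983, §2]; M. Lüscher, U. Wolff, NPB 339 (1990) 222
[cite: LuscherWolff1990].
-/

set_option autoImplicit false

noncomputable section

open MeasureTheory Filter Topology
open Literature.MathematicalPhysics.QuantumFieldTheory
open Literature.MathematicalPhysics.QuantumLattice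
open scoped BigOperators

namespace Summit.QuantumFields.YangMills.Theorems.FemtoTransferGap.PolyakovLift

open Summit.QuantumFields.YangMills.Theorems.FemtoTransferGap

/-! ## §1 The covariance form of two insertions -/

section Cov

variable {L : ℕ} [NeZero L]

/-- **`⟨ins φ O, ins φ O'⟩ = ⟨Oφ, O'φ⟩ − ⟨φ, Oφ⟩⟨φ, O'φ⟩`** for `‖φ‖² = 1` and physical `φ, O, O'` — the `l2` pairing of two vacuum-subtracted
insertions is the COVARIANCE of `O` and `O'` in the state `φ²`. [cite: LuscherWolff1990] -/
theorem l2_ins_ins {φ O O' : GaugeConfig 3 L SU2 → ℝ} (hφ : IsPhys φ) (hO : IsPhys O) (hO' : IsPhys O') (hφ1 : l2 φ φ = 1) :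
    l2 (OpPlat.ins φ O) (OpPlat.ins φ O') = l2 (O * φ) (O' * φ) - l2 φ (O * φ) * l2 φ (O' * φ) := by
  set Φ : physSubmodule L := ⟨φ, hφ⟩ with hΦ
  set OΦ : physSubmodule L := ⟨O * φ, OpPlat.isPhys_mul hO hφ⟩ with hOΦ
  set OΦ' : physSubmodule L := ⟨O' * φ, OpPlat.isPhys_mul hO' hφ⟩ with hOΦ'
  have hins : OpPlat.ins φ O = ((OΦ - l2 φ (O * φ) • Φ : physSubmodule L) : GaugeConfig 3 L SU2 → ℝ) := by
    rw [OpPlat.ins_eq]; rfl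
  have hins' : OpPlat.ins φ O' = ((OΦ' - l2 φ (O' * φ) • Φ : physSubmodule L) : GaugeConfig 3 L SU2 → ℝ) := by
    rw [OpPlat.ins_eq]; rfl
  have hc : l2Form L OΦ Φ = l2 φ (O * φ) := by rw [l2Form_apply, l2_comm]
  have hc' : l2Form L Φ OΦ' = l2 φ (O' * φ) := by rw [l2Form_apply]
  have h1 : l2Form L Φ Φ = 1 := by simpa [l2Form_apply] using hφ1
  have h : l2Form L (OΦ - l2 φ (O * φ) • Φ) (OΦ' - l2 φ (O' * φ) • Φ) = l2Form L OΦ OΦ' - l2 φ (O * φ) * l2 φ (O' * φ) := by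
    simp only [map_sub, map_smul, LinearMap.sub_apply, LinearMap.smul_apply, smul_eq_mul, hc, hc', h1]
    ring
  rw [hins, hins', ← l2Form_apply, h, l2Form_apply]

end Cov

/-! ## §2 The vacuum functions of flowed Polyakov insertions are invariant under one-site axis permutations -/

section Invariance

variable {L : ℕ} [NeZero L]

/-- One-point invariance at the fine level: `⟨φ, (F∘P)·φ⟩ = ⟨φ, F·φ⟩` for a raw vacuum `φ` (`φ ∘ P = φ`, `P` measure preserving). [folklore] -/
theorem l2_vac_mul_comp_configPerm (β : ℝ) {φ : GaugeConfig 3 L SU2 → ℝ} (hφ : IsPhys φ)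
    (heig : transferApply β φ = levelValue su2Rep L β 0 • φ) (π : Equiv.Perm (Fin 3)) (F : GaugeConfig 3 L SU2 → ℝ) :
    l2 φ ((fun U => F (configPerm π U)) * φ) = l2 φ (F * φ) := by
  have hφP : ∀ U, φ (configPerm π U) = φ U := rawVacuum_comp_configPerm β hφ heig π
  unfold l2
  have hfun : (fun U => φ U * ((fun U => F (configPerm π U)) * φ) U) =
      fun U => (fun V => φ V * ((F * φ) V)) (configPerm π U) := by
    funext U; simp only [Pi.mul_apply, hφP]
  rw [hfun]
  exact (measurePreserving_configPerm' π).integral_comp' (f := configPerm π) (fun V => φ V * ((F * φ) V))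

/-- Two-point invariance at the fine level: `⟨(F∘P)φ, (H∘P)φ⟩ = ⟨Fφ, Hφ⟩` for a raw vacuum `φ`. [folklore] -/
theorem l2_mul_vac_comp_configPerm (β : ℝ) {φ : GaugeConfig 3 L SU2 → ℝ} (hφ : IsPhys φ)
    (heig : transferApply β φ = levelValue su2Rep L β 0 • φ) (π : Equiv.Perm (Fin 3)) (F H : GaugeConfig 3 L SU2 → ℝ) :
    l2 ((fun U => F (configPerm π U)) * φ) ((fun U => H (configPerm π U)) * φ) = l2 (F * φ) (H * φ) := by
  have hφP : ∀ U, φ (configPerm π U) = φ U := rawVacuum_comp_configPerm β hφ heig π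
  unfold l2
  have hfun : (fun U => ((fun U => F (configPerm π U)) * φ) U * (((fun U => H (configPerm π U)) * φ) U)) =
      fun U => (fun V => (F * φ) V * ((H * φ) V)) (configPerm π U) := by
    funext U; simp only [Pi.mul_apply, hφP]
  rw [hfun]
  exact (measurePreserving_configPerm' π).integral_comp' (f := configPerm π) (fun V => (F * φ) V * ((H * φ) V))

/-- **One-point function of a flowed Polyakov insertion is `S₃`-invariant**: `⟨φ, ((f∘P_π)∘Π_t)φ⟩ = ⟨φ, (f∘Π_t)φ⟩` (raw vacuum `φ`).
[cite: Luscher1983, §2] -/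
theorem l2_vac_flowLiftAt_comp_configPerm (β : ℝ) {φ : GaugeConfig 3 L SU2 → ℝ} (hφ : IsPhys φ)
    (heig : transferApply β φ = levelValue su2Rep L β 0 • φ) (π : Equiv.Perm (Fin 3)) (t : ℝ) (f : GaugeConfig 3 1 SU2 → ℝ) :
    l2 φ (flowLiftAt 0 t (fun V => f (configPerm π V)) * φ) = l2 φ (flowLiftAt 0 t f * φ) := by
  rw [← flowLiftAt_zero_comp_configPerm, l2_vac_mul_comp_configPerm β hφ heig]

/-- **Two-point function of flowed Polyakov insertions is `S₃`-invariant**. [cite: Luscher1983, §2] -/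
theorem l2_flowLiftAt_vac_comp_configPerm (β : ℝ) {φ : GaugeConfig 3 L SU2 → ℝ} (hφ : IsPhys φ)
    (heig : transferApply β φ = levelValue su2Rep L β 0 • φ) (π : Equiv.Perm (Fin 3)) (t : ℝ) (f h : GaugeConfig 3 1 SU2 → ℝ) :
    l2 (flowLiftAt 0 t (fun V => f (configPerm π V)) * φ) (flowLiftAt 0 t (fun V => h (configPerm π V)) * φ) =
      l2 (flowLiftAt 0 t f * φ) (flowLiftAt 0 t h * φ) := by
  rw [← flowLiftAt_zero_comp_configPerm, ← flowLiftAt_zero_comp_configPerm, l2_mul_vac_comp_configPerm β hφ heig]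

/-- ★ **The covariance form of flowed Polyakov insertions is `S₃`-invariant**: `⟨u_{f∘P_π}, u_{h∘P_π}⟩ = ⟨u_f, u_h⟩` for every raw vacuum `φ`
(`IsPhys φ`, `‖φ‖² = 1`, `K_βφ = λ₀φ`), every flow time, every pair of physical one-site functions. [cite: Luscher1983, §2] [cite: LuscherWolff1990] -/
theorem l2_ins_flowLiftAt_comp_configPerm (β : ℝ) {φ : GaugeConfig 3 L SU2 → ℝ} (hφ : IsPhys φ) (hφ1 : l2 φ φ = 1)
    (heig : transferApply β φ = levelValue su2Rep L β 0 • φ) (π : Equiv.Perm (Fin 3)) (t : ℝ)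
    {f h : GaugeConfig 3 1 SU2 → ℝ} (hf : IsPhys f) (hh : IsPhys h) :
    l2 (OpPlat.ins φ (flowLiftAt 0 t fun V => f (configPerm π V))) (OpPlat.ins φ (flowLiftAt 0 t fun V => h (configPerm π V))) =
      l2 (OpPlat.ins φ (flowLiftAt 0 t f)) (OpPlat.ins φ (flowLiftAt 0 t h)) := by
  rw [l2_ins_ins hφ (isPhys_flowLiftAt 0 t (hf.comp_configPerm π)) (isPhys_flowLiftAt 0 t (hh.comp_configPerm π)) hφ1,
    l2_ins_ins hφ (isPhys_flowLiftAt 0 t hf) (isPhys_flowLiftAt 0 t hh) hφ1,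
    l2_flowLiftAt_vac_comp_configPerm β hφ heig, l2_vac_flowLiftAt_comp_configPerm β hφ heig,
    l2_vac_flowLiftAt_comp_configPerm β hφ heig]

end Invariance

/-! ## §3 ★ Symmetry zeros of the covariance -/

section Zeros

variable {L : ℕ} [NeZero L]

/-- Averaging lemma: for weights `w` on `S₃` with `Σ_π w(π)·h(P_π V) = 0` for all `V`, and any physical fine `X`:
`Σ_π w(π)·⟨X, ((h∘P_π)∘Π_t)·φ⟩ = 0` (push the finite sum inside the integral; the flowed lift is evaluation at `Π_t U`). [folklore] -/
theorem sum_weight_l2_flowLiftAt_eq_zero {φ X : GaugeConfig 3 L SU2 → ℝ} (hφ : IsPhys φ) (hX : IsPhys X) (t : ℝ)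
    {h : GaugeConfig 3 1 SU2 → ℝ} (hh : IsPhys h) (w : Equiv.Perm (Fin 3) → ℝ)
    (hsum : ∀ V, ∑ π : Equiv.Perm (Fin 3), w π * h (configPerm π V) = 0) :
    ∑ π : Equiv.Perm (Fin 3), w π * l2 X (flowLiftAt 0 t (fun V => h (configPerm π V)) * φ) = 0 := by
  have hint : ∀ π ∈ (Finset.univ : Finset (Equiv.Perm (Fin 3))),
      Integrable (fun U => w π * (X U * ((flowLiftAt (L := L) 0 t (fun V => h (configPerm π V)) * φ) U))) (configMeasure SU2 L) :=
    fun π _ => (hX.integrable_mul (OpPlat.isPhys_mul (isPhys_flowLiftAt 0 t (hh.comp_configPerm π)) hφ)).const_mul _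
  unfold l2
  simp_rw [← integral_const_mul]
  rw [← integral_finsetSum _ hint]
  refine integral_eq_zero_of_ae (ae_of_all _ fun U => ?_)
  have hterm : ∀ π : Equiv.Perm (Fin 3), w π * (X U * ((flowLiftAt (L := L) 0 t (fun V => h (configPerm π V)) * φ) U)) =
      X U * φ U * (w π * h (configPerm π (polyakovSite 0 (wilsonFlow t U)))) := fun π => by
    simp only [Pi.mul_apply, flowLiftAt]; ring
  simp only [hterm, ← Finset.mul_sum, hsum, mul_zero, Pi.zero_apply]

/-- ★ **SYMMETRY ZERO (invariant vs. non-invariant)**: for a raw vacuum `φ` and physical one-site `f`, `h` with `f` INVARIANT under all axis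
permutations and `h` of VANISHING `S₃`-AVERAGE (`Σ_π h∘P_π = 0`), the flowed insertions are EXACTLY uncorrelated: `⟨u_f, u_h⟩ = 0`.
(Average the invariant covariance form over `S₃`.) [cite: Luscher1983, §2] [cite: LuscherWolff1990] -/
theorem l2_ins_flowLiftAt_eq_zero_of_invariant (β : ℝ) {φ : GaugeConfig 3 L SU2 → ℝ} (hφ : IsPhys φ) (hφ1 : l2 φ φ = 1)
    (heig : transferApply β φ = levelValue su2Rep L β 0 • φ) (t : ℝ) {f h : GaugeConfig 3 1 SU2 → ℝ} (hf : IsPhys f) (hh : IsPhys h)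
    (hfinv : ∀ π : Equiv.Perm (Fin 3), (fun V => f (configPerm π V)) = f)
    (hhavg : ∀ V, ∑ π : Equiv.Perm (Fin 3), h (configPerm π V) = 0) :
    l2 (OpPlat.ins φ (flowLiftAt 0 t f)) (OpPlat.ins φ (flowLiftAt 0 t h)) = 0 := by
  have hF : IsPhys (flowLiftAt (L := L) 0 t f) := isPhys_flowLiftAt 0 t hf
  have hcard : (Fintype.card (Equiv.Perm (Fin 3)) : ℝ) ≠ 0 := Nat.cast_ne_zero.mpr Fintype.card_ne_zero
  have hsum1 : ∀ V, ∑ π : Equiv.Perm (Fin 3), (1 : ℝ) * h (configPerm π V) = 0 := fun V => by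
    simpa only [one_mul] using hhavg V
  -- two-point: `A = ⟨F_f φ, F_h φ⟩` equals each `⟨F_f φ, F_{h∘P_π} φ⟩`, whose sum vanishes
  have hA : l2 (flowLiftAt 0 t f * φ) (flowLiftAt 0 t h * φ) = 0 := by
    have hπ : ∀ π : Equiv.Perm (Fin 3), l2 (flowLiftAt 0 t f * φ) (flowLiftAt 0 t h * φ) =
        (1 : ℝ) * l2 (flowLiftAt 0 t f * φ) (flowLiftAt 0 t (fun V => h (configPerm π V)) * φ) := fun π => by
      rw [one_mul, ← l2_flowLiftAt_vac_comp_configPerm β hφ heig π t f h, hfinv π]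
    have hs := sum_weight_l2_flowLiftAt_eq_zero hφ (OpPlat.isPhys_mul hF hφ) t hh (fun _ => 1) hsum1
    rw [← Finset.sum_congr rfl fun π _ => hπ π, Finset.sum_const, Finset.card_univ, nsmul_eq_mul] at hs
    exact (mul_eq_zero.mp hs).resolve_left hcard
  -- one-point: `B = ⟨φ, F_h φ⟩` equals each `⟨φ, F_{h∘P_π} φ⟩`, whose sum vanishes
  have hB : l2 φ (flowLiftAt 0 t h * φ) = 0 := by
    have hπ : ∀ π : Equiv.Perm (Fin 3), l2 φ (flowLiftAt 0 t h * φ) =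
        (1 : ℝ) * l2 φ (flowLiftAt 0 t (fun V => h (configPerm π V)) * φ) := fun π => by
      rw [one_mul, l2_vac_flowLiftAt_comp_configPerm β hφ heig π t h]
    have hs := sum_weight_l2_flowLiftAt_eq_zero hφ hφ t hh (fun _ => 1) hsum1
    rw [← Finset.sum_congr rfl fun π _ => hπ π, Finset.sum_const, Finset.card_univ, nsmul_eq_mul] at hs
    exact (mul_eq_zero.mp hs).resolve_left hcard
  rw [l2_ins_ins hφ hF (isPhys_flowLiftAt 0 t hh) hφ1, hA, hB, mul_zero, sub_zero]

/-- ★ **SYMMETRY ZERO (sign type vs. no sign component)**: if `f ∘ P_π = sgn(π)·f` for all `π` and `Σ_π sgn(π)·h∘P_π = 0`, then `⟨u_f, u_h⟩ = 0`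
(and `⟨φ, (f∘Π_t)φ⟩ = 0` by a transposition). [cite: Luscher1983, §2] [cite: LuscherWolff1990] -/
theorem l2_ins_flowLiftAt_eq_zero_of_sign (β : ℝ) {φ : GaugeConfig 3 L SU2 → ℝ} (hφ : IsPhys φ) (hφ1 : l2 φ φ = 1)
    (heig : transferApply β φ = levelValue su2Rep L β 0 • φ) (t : ℝ) {f h : GaugeConfig 3 1 SU2 → ℝ} (hf : IsPhys f) (hh : IsPhys h)
    (hfsgn : ∀ π : Equiv.Perm (Fin 3), (fun V => f (configPerm π V)) = ((Equiv.Perm.sign π : ℤ) : ℝ) • f)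
    (hhavg : ∀ V, ∑ π : Equiv.Perm (Fin 3), ((Equiv.Perm.sign π : ℤ) : ℝ) * h (configPerm π V) = 0) :
    l2 (OpPlat.ins φ (flowLiftAt 0 t f)) (OpPlat.ins φ (flowLiftAt 0 t h)) = 0 := by
  have hF : IsPhys (flowLiftAt (L := L) 0 t f) := isPhys_flowLiftAt 0 t hf
  have hcard : (Fintype.card (Equiv.Perm (Fin 3)) : ℝ) ≠ 0 := Nat.cast_ne_zero.mpr Fintype.card_ne_zero
  have hsgn_sq : ∀ π : Equiv.Perm (Fin 3), (((Equiv.Perm.sign π : ℤ) : ℝ)) * ((Equiv.Perm.sign π : ℤ) : ℝ) = 1 := fun π => by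
    rcases Int.units_eq_one_or (Equiv.Perm.sign π) with h1 | h1 <;> simp [h1]
  -- the flowed lift of `sgn(π)•f` is `sgn(π)•` the flowed lift
  have hlift : ∀ π : Equiv.Perm (Fin 3), flowLiftAt (L := L) 0 t (fun V => f (configPerm π V)) * φ =
      ((Equiv.Perm.sign π : ℤ) : ℝ) • (flowLiftAt 0 t f * φ) := fun π => by
    rw [hfsgn π]; funext U; simp only [Pi.mul_apply, Pi.smul_apply, flowLiftAt, smul_eq_mul]; ring
  -- two-point: `A = sgn(π)·⟨F_f φ, F_{h∘P_π} φ⟩` for each `π`; summing, `6A = 0`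
  have hA : l2 (flowLiftAt 0 t f * φ) (flowLiftAt 0 t h * φ) = 0 := by
    have hπ : ∀ π : Equiv.Perm (Fin 3), l2 (flowLiftAt 0 t f * φ) (flowLiftAt 0 t h * φ) =
        ((Equiv.Perm.sign π : ℤ) : ℝ) * l2 (flowLiftAt 0 t f * φ) (flowLiftAt 0 t (fun V => h (configPerm π V)) * φ) := fun π => by
      rw [← l2_flowLiftAt_vac_comp_configPerm β hφ heig π t f h, hlift π, l2_smul_left]
    have hs := sum_weight_l2_flowLiftAt_eq_zero hφ (OpPlat.isPhys_mul hF hφ) t hh _ hhavg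
    rw [← Finset.sum_congr rfl fun π _ => hπ π, Finset.sum_const, Finset.card_univ, nsmul_eq_mul] at hs
    exact (mul_eq_zero.mp hs).resolve_left hcard
  -- one-point: `⟨φ, F_f φ⟩ = −⟨φ, F_f φ⟩` by the transposition `(0 1)`
  have hB : l2 φ (flowLiftAt 0 t f * φ) = 0 := by
    set τ : Equiv.Perm (Fin 3) := Equiv.swap 0 1 with hτ
    have hsτ : ((Equiv.Perm.sign τ : ℤ) : ℝ) = -1 := by
      rw [hτ, Equiv.Perm.sign_swap (by decide)]; simp
    have h1 := l2_vac_flowLiftAt_comp_configPerm β hφ heig τ t f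
    rw [hlift τ, hsτ, l2_comm, l2_smul_left, l2_comm] at h1
    linarith
  rw [l2_ins_ins hφ hF (isPhys_flowLiftAt 0 t hh) hφ1, hA, hB, zero_mul, sub_zero]

end Zeros

/-! ## §4 Clause (o2) for symmetry-separated channel pairs of a lift basis -/

section Clause

/-- **Clause (o2) holds EXACTLY (any `C ≥ 0`) for symmetry-separated pairs of a lift basis**: for a raw vacuum `φ`, a lift basis `(ω, g)` at
any coupling `B`, the line's flow time `flowTime β L` (indeed any), and two channels `i ≠ l` such that one of `g_i`, `g_l` is `S₃`-invariant and
the other has vanishing `S₃`-average, `|⟨u_i, u_l⟩| ≤ C·λ·√⟨u_i,u_i⟩√⟨u_l,u_l⟩` because the left side is `0`.  The OPEN part of (o2) is thus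
confined to pairs inside one `S₃`-isotypic class. [cite: Luscher1983, §2] -/
theorem liftFamily_o2_of_symmetrySeparated {L : ℕ} [NeZero L] (β : ℝ) {φ : GaugeConfig 3 L SU2 → ℝ} (hvac : IsRawVacuum β φ)
    {B : ℝ} {k : ℕ} {ω : GaugeConfig 3 1 SU2 → ℝ} {g : Fin k → (GaugeConfig 3 1 SU2 → ℝ)} (hbasis : LiftBasis B k ω g)
    {C : ℝ} (hC : 0 ≤ C) (i l : Fin k)
    (hsep : ((∀ π : Equiv.Perm (Fin 3), (fun V => g i (configPerm π V)) = g i) ∧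
        (∀ V, ∑ π : Equiv.Perm (Fin 3), g l (configPerm π V) = 0)) ∨
      ((∀ π : Equiv.Perm (Fin 3), (fun V => g l (configPerm π V)) = g l) ∧
        (∀ V, ∑ π : Equiv.Perm (Fin 3), g i (configPerm π V) = 0))) :
    |l2 (liftFamily β φ g i) (liftFamily β φ g l)| ≤
      C * luscherLambda β L *
        (Real.sqrt (l2 (liftFamily β φ g i) (liftFamily β φ g i)) * Real.sqrt (l2 (liftFamily β φ g l) (liftFamily β φ g l))) := by
  obtain ⟨hφ, hφ1, heig⟩ := hvac
  have hg : ∀ j, IsPhys (g j) := hbasis.2.2.2.2.1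
  have hzero : l2 (liftFamily β φ g i) (liftFamily β φ g l) = 0 := by
    rcases hsep with ⟨hinv, havg⟩ | ⟨hinv, havg⟩
    · exact l2_ins_flowLiftAt_eq_zero_of_invariant β hφ hφ1 heig (flowTime β L) (hg i) (hg l) hinv havg
    · rw [show l2 (liftFamily β φ g i) (liftFamily β φ g l) = l2 (liftFamily β φ g l) (liftFamily β φ g i) from l2_comm _ _]
      exact l2_ins_flowLiftAt_eq_zero_of_invariant β hφ hφ1 heig (flowTime β L) (hg l) (hg i) hinv havg
  rw [hzero, abs_zero]
  exact mul_nonneg (mul_nonneg hC (KTRCalibration.luscherLambda_nonneg β L))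
    (mul_nonneg (Real.sqrt_nonneg _) (Real.sqrt_nonneg _))

end Clause

end Summit.QuantumFields.YangMills.Theorems.FemtoTransferGap.PolyakovLift

end
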